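import Literature.NumberTheory.Transcendental.NesterenkoUResultantElimIdeal
import Literature.NumberTheory.Transcendental.NesterenkoEliminationProp44Holds
import Literature.NumberTheory.Transcendental.NesterenkoEliminationProp47Proofs
import Mathlib.RingTheory.GradedAlgebra.Radical
import Mathlib.RingTheory.Lasker
import HarnessLib

/-!
# LNM 1752 Ch. 10 Lemma 3.5 1) over the constant field: `deg J ≤ deg I · deg Q` for a cut `(I, Q) ⊂ J`

`Literature/NumberTheory/Transcendental/NesterenkoDegreeCut.lean` — proofs only, for
`K = ℚ`, in the tree's Chow-form vocabulary (`NesterenkoElimination.lean`: `elimIdeal`, `chowForm`,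
`ideg`, `IsUnmixedOfRank`, `primaryExponent`).

**Lemma 3.5 1)** (LNM 1752 Ch. 10, p. 155, = [Nes6, Lemma 4] in the height-free part): let
`I ⊂ J ⊂ ℚ[x₀, …, x_m]` be homogeneous unmixed ideals, `dim J = dim I − 1` (ranks `s + 1` and `s`,
`1 ≤ s`, `s + 1 ≤ m`), `Q` a form of degree `d ≥ 1` lying in no associated prime of `I`, and
`(I, Q) ⊂ J`. Then `deg J ≤ deg I · deg Q` (`ideg_le_ideg_mul_of_sup_le`).

PROOF (through the `u`-resultant, not through components of `J`). Let `I = ⋂_P P` be a reduced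
primary decomposition, `𝔭_P = √P`, `k_P` the exponents. For each `P` the `u`-resultant
`G_P = Res(F_{𝔭_P}, Q) ∈ ℚ[u₁, …, u_s]` lies in the elimination ideal `\overline{(𝔭_P, Q)}(s)`
(`uResultant_mem_elimIdeal_sup`, [Nes77 §2 Lemma 6]) and is homogeneous of degree
`deg 𝔭_P · d` in the group `u₁` (`blockDeg_uResultant`). The elimination ideal is multiplicative
(`mul_mem_elimIdeal`: `G x_j^M ∈ (A, L)`, `H x_j^{M'} ∈ (B, L)` give `GH x_j^{M+M'} ∈ (AB, L)`), and
`∏_P (𝔭_P + (Q))^{k_P} ⊆ ∏_P (𝔭_P^{k_P} + (Q)) ⊆ (∏_P 𝔭_P^{k_P}) + (Q) ⊆ I + (Q) ⊆ J`, so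
`G = ∏_P G_P^{k_P} ∈ \overline{J}(s) = (F_J)`: `F_J ∣ G`. Both are homogeneous in the group `u₁`,
of degrees `deg J` and `∑ k_P deg 𝔭_P · d = deg I · d` (Prop. 4.7 1)); a homogeneous divisor of a
non-zero homogeneous polynomial has smaller degree (`IsWeightedHomogeneous.weight_le_of_dvd`).

No definitions, no named facts.

## References

* [NesterenkoPhilippon2001] LNM 1752, Ch. 10 Lemma 3.5 (p. 155); Ch. 3 Prop. 4.7 1), 4.11 1).
* [Nesterenko1977] Yu. V. Nesterenko, Izv. Akad. Nauk SSSR Ser. Mat. 41 (1977), §2 Lemma 6 and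
  Lemma 4 (= [Nes6, Lemma 4] of LNM 1752 Ch. 10).
-/

noncomputable section

open MvPolynomial
open Literature.NumberTheory.Transcendental.PhilipponMain

attribute [local instance] MvPolynomial.gradedAlgebra

namespace Literature.NumberTheory.Transcendental

namespace Nesterenko

variable {m : ℕ}

/-! ### A weighted-homogeneous divisor of a non-zero weighted-homogeneous polynomial has smaller weight -/

/-- **Weights of divisors**: over a domain, if `F` is weighted-homogeneous of weight `a`, `G ≠ 0` is
weighted-homogeneous of weight `N` and `F ∣ G`, then `a ≤ N` (the component of `F · H` of weight
`a + j` is `F · H_j`; if `a > N` all of them vanish, so `H = 0`). [folklore] -/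
theorem _root_.MvPolynomial.IsWeightedHomogeneous.weight_le_of_dvd {σ R : Type*} [CommRing R]
    [IsDomain R] {w : σ → ℕ} {F G : MvPolynomial σ R} {a N : ℕ}
    (hF : F.IsWeightedHomogeneous w a) (hG : G.IsWeightedHomogeneous w N) (hG0 : G ≠ 0)
    (h : F ∣ G) : a ≤ N := by
  classical
  letI := MvPolynomial.weightedGradedAlgebra R w
  obtain ⟨H, rfl⟩ := h
  by_contra hlt
  push Not at hlt
  have hF0 : F ≠ 0 := left_ne_zero_of_mul hG0
  apply hG0
  suffices hH : H = 0 by rw [hH, mul_zero]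
  rw [← DirectSum.sum_support_decompose (weightedHomogeneousSubmodule R w) H]
  refine Finset.sum_eq_zero fun j _ => ?_
  have hFmem : F ∈ weightedHomogeneousSubmodule R w a := hF
  have hGmem : F * H ∈ weightedHomogeneousSubmodule R w N := hG
  have h1 : (DirectSum.decompose (weightedHomogeneousSubmodule R w) (F * H) (a + j) :
      MvPolynomial σ R) = F * DirectSum.decompose (weightedHomogeneousSubmodule R w) H j :=
    DirectSum.coe_decompose_mul_add_of_left_mem (𝒜 := weightedHomogeneousSubmodule R w) hFmem
  have h2 : (DirectSum.decompose (weightedHomogeneousSubmodule R w) (F * H) (a + j) :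
      MvPolynomial σ R) = 0 :=
    DirectSum.decompose_of_mem_ne (ℳ := weightedHomogeneousSubmodule R w) hGmem (by omega)
  rw [h2] at h1
  exact (mul_eq_zero.mp h1.symm).resolve_left hF0

/-- Powers of weighted-homogeneous polynomials: Mathlib's `MvPolynomial.IsWeightedHomogeneous.pow`
(same statement); deprecated restatement declared into Mathlib's namespace by the original file
(dedup-01136, 2026-08-16). [folklore] -/
@[deprecated MvPolynomial.IsWeightedHomogeneous.pow (since := "2026-08-16")]
theorem _root_.MvPolynomial.IsWeightedHomogeneous.pow' {σ R M : Type*} [CommSemiring R]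
    [AddCommMonoid M] {w : σ → M} {φ : MvPolynomial σ R} {n : M} (h : φ.IsWeightedHomogeneous w n)
    (k : ℕ) : (φ ^ k).IsWeightedHomogeneous w (k • n) :=
  h.pow k

/-! ### The elimination ideal is multiplicative -/

/-- `(A, L₁, …, L_r) · (B, L₁, …, L_r) ⊆ (AB, L₁, …, L_r)`. [folklore] -/
theorem extIdeal_mul_le (A B : Ideal (Rx m)) (r : ℕ) :
    extIdeal A r * extIdeal B r ≤ extIdeal (A * B) r := by
  rw [extIdeal, extIdeal, extIdeal, Ideal.sup_mul, Ideal.mul_sup, Ideal.mul_sup, ← Ideal.map_mul]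
  refine sup_le (sup_le le_sup_left ?_) (sup_le ?_ ?_)
  · exact Ideal.mul_le_left.trans le_sup_right
  · exact Ideal.mul_le_right.trans le_sup_right
  · exact Ideal.mul_le_right.trans le_sup_right

/-- **`Ī` is multiplicative**: `G ∈ \overline{A}(r)`, `H ∈ \overline{B}(r)` give `GH ∈ \overline{AB}(r)`. [folklore] -/
theorem mul_mem_elimIdeal {A B : Ideal (Rx m)} {r : ℕ} {G H : RU r m} (hG : G ∈ elimIdeal A r)
    (hH : H ∈ elimIdeal B r) : G * H ∈ elimIdeal (A * B) r := by
  obtain ⟨M, hM, hG⟩ := (mem_elimIdeal_iff A r G).mp hG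
  obtain ⟨M', -, hH⟩ := (mem_elimIdeal_iff B r H).mp hH
  refine (mem_elimIdeal_iff _ r _).mpr ⟨M + M', by omega, fun j => ?_⟩
  have e : rename Sum.inl (G * H) * (X (Sum.inr j) : RUX r m) ^ (M + M') =
      (rename Sum.inl G * X (Sum.inr j) ^ M) * (rename Sum.inl H * X (Sum.inr j) ^ M') := by
    rw [map_mul, pow_add]; ring
  rw [e]
  exact extIdeal_mul_le A B r (Ideal.mul_mem_mul (hG j) (hH j))

/-- `1 ∈ \overline{(1)}(r)`. [folklore] -/
theorem one_mem_elimIdeal_top (r : ℕ) : (1 : RU r m) ∈ elimIdeal (⊤ : Ideal (Rx m)) r := by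
  refine (mem_elimIdeal_iff _ r _).mpr ⟨1, one_pos, fun j => ?_⟩
  have : extIdeal (⊤ : Ideal (Rx m)) r = ⊤ := by
    rw [extIdeal, Ideal.map_top, top_sup_eq]
  rw [this]
  exact Submodule.mem_top

/-- Powers: `G ∈ \overline{A}(r)` gives `G^k ∈ \overline{A^k}(r)`. [folklore] -/
theorem pow_mem_elimIdeal {A : Ideal (Rx m)} {r : ℕ} {G : RU r m} (hG : G ∈ elimIdeal A r) (k : ℕ) :
    G ^ k ∈ elimIdeal (A ^ k) r := by
  induction k with
  | zero => rw [pow_zero, pow_zero, Ideal.one_eq_top]; exact one_mem_elimIdeal_top r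
  | succ k ih => rw [pow_succ, pow_succ]; exact mul_mem_elimIdeal ih hG

/-- Products of powers. [folklore] -/
theorem prod_pow_mem_elimIdeal {ι : Type*} (t : Finset ι) (A : ι → Ideal (Rx m)) (k : ι → ℕ)
    {r : ℕ} (G : ι → RU r m) (h : ∀ i ∈ t, G i ∈ elimIdeal (A i) r) :
    ∏ i ∈ t, G i ^ k i ∈ elimIdeal (∏ i ∈ t, A i ^ k i) r := by
  classical
  induction t using Finset.induction_on with
  | empty =>
    rw [Finset.prod_empty, Finset.prod_empty, Ideal.one_eq_top]
    exact one_mem_elimIdeal_top r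
  | insert a t ha ih =>
    rw [Finset.prod_insert ha, Finset.prod_insert ha]
    exact mul_mem_elimIdeal (pow_mem_elimIdeal (h a (Finset.mem_insert_self a t)) _)
      (ih fun i hi => h i (Finset.mem_insert_of_mem hi))

/-! ### Ideal inclusions -/

/-- `∏ (P_i + S) ⊆ (∏ P_i) + S`. [folklore] -/
theorem prod_sup_le {R ι : Type*} [CommSemiring R] (t : Finset ι) (P : ι → Ideal R) (S : Ideal R) :
    ∏ i ∈ t, (P i ⊔ S) ≤ (∏ i ∈ t, P i) ⊔ S := by
  classical
  induction t using Finset.induction_on with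
  | empty => rw [Finset.prod_empty, Finset.prod_empty]; exact le_sup_left
  | insert a t ha ih =>
    rw [Finset.prod_insert ha, Finset.prod_insert ha]
    refine (Ideal.mul_mono le_rfl ih).trans ?_
    rw [Ideal.sup_mul, Ideal.mul_sup, Ideal.mul_sup]
    refine sup_le (sup_le le_sup_left (Ideal.mul_le_left.trans le_sup_right))
      (sup_le (Ideal.mul_le_right.trans le_sup_right) (Ideal.mul_le_right.trans le_sup_right))

/-! ### Lemma 3.5 1) -/

set_option maxHeartbeats 800000 in
/-- **LNM 1752 Ch. 10 Lemma 3.5 1), `K = ℚ`**: let `I ⊂ ℚ[x₀, …, x_m]` be a homogeneous unmixed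
ideal of rank `s + 1` (`1 ≤ s`, `s + 1 ≤ m`), `J` a homogeneous unmixed ideal of rank `s`, `Q` a
form of degree `d ≥ 1` lying in no associated prime of `I`, and `(I, Q) ⊆ J`. Then
`deg J ≤ deg I · d`. [cite: NesterenkoPhilippon2001, Ch. 10 Lemma 3.5 1) (p. 155)] -/
theorem ideg_le_ideg_mul_of_sup_le {s : ℕ} (hs : 1 ≤ s) (hsm : s + 1 ≤ m) {I J : Ideal (Rx m)}
    (hIh : I.IsHomogeneous (homogeneousSubmodule (Fin (m + 1)) ℚ)) (hI : IsUnmixedOfRank I (s + 1))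
    (hJh : J.IsHomogeneous (homogeneousSubmodule (Fin (m + 1)) ℚ)) (hJ : IsUnmixedOfRank J s)
    {Q : Rx m} {d : ℕ} (hQ : Q.IsHomogeneous d) (hd : 1 ≤ d)
    (hQI : ∀ 𝔭 ∈ I.associatedPrimes, Q ∉ 𝔭) (hle : I ⊔ Ideal.span {Q} ≤ J) :
    ideg J s ≤ ideg I (s + 1) * d := by
  classical
  -- a reduced primary decomposition of `I`
  obtain ⟨t, ht⟩ : ∃ t : Finset (Ideal (Rx m)), Submodule.IsMinimalPrimaryDecomposition I t :=
    Submodule.IsLasker.exists_isMinimalPrimaryDecomposition (Submodule.isLasker (Rx m) (Rx m)) I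
  have hrad : ∀ P ∈ t, (P : Ideal (Rx m)).radical ∈ I.associatedPrimes := fun P hP => by
    have h := ht.mem_associatedPrimes hP
    rwa [Submodule.colon_univ] at h
  have hprime : ∀ P ∈ t, P.radical.IsPrime := fun P hP => Ideal.isPrime_radical (ht.primary hP)
  have hhom : ∀ P ∈ t, P.radical.IsHomogeneous (homogeneousSubmodule (Fin (m + 1)) ℚ) := fun P hP =>
    (isHomogeneous_of_mem_isMinimalPrimaryDecomposition hIh hI ht hP).radical
  have hunm : ∀ P ∈ t, IsUnmixedOfRank P.radical (s + 1) := fun P hP =>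
    isUnmixedOfRank_of_isPrime (hprime P hP) (hI.2 _ (hrad P hP))
  have hQP : ∀ P ∈ t, Q ∉ P.radical := fun P hP => hQI _ (hrad P hP)
  -- `t` is non-empty and `Q ≠ 0`
  have htne : t.Nonempty := by
    by_contra h
    rw [Finset.not_nonempty_iff_eq_empty] at h
    have := ht.inf_eq
    rw [h, Finset.inf_empty] at this
    exact hI.1 (this.symm.trans rfl ▸ rfl)
  obtain ⟨P₀, hP₀⟩ := htne
  have hQ0 : Q ≠ 0 := fun h0 => hQP P₀ hP₀ (h0 ▸ Ideal.zero_mem _)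
  obtain ⟨q, Q₀, hq, hQQ₀, hQ₀⟩ := exists_int_model hQ hQ0
  -- the `u`-resultants of the associated primes with `Q`
  set w : Fin s × Fin (m + 1) → ℕ := fun v => if v.1 = (⟨0, hs⟩ : Fin s) then 1 else 0 with hw
  set Gf : Ideal (Rx m) → RU s m := fun P => uResultant P.radical s d Q₀ with hGf
  have hGmem : ∀ P ∈ t, Gf P ∈ elimIdeal (P.radical ⊔ Ideal.span {Q}) s := fun P hP =>
    uResultant_mem_elimIdeal_sup hs (hprime P hP) (hhom P hP) (hunm P hP) hq hQQ₀ hQ₀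
  have hGne : ∀ P ∈ t, Gf P ≠ 0 := fun P hP =>
    uResultant_ne_zero hs (hprime P hP) (hhom P hP) (hunm P hP) hQ hd (hQP P hP) hQQ₀ hQ₀
  have hGwh : ∀ P ∈ t, IsWeightedHomogeneous w (Gf P) (ideg P.radical (s + 1) * d) := fun P hP => by
    have h := uResultant_isWeightedHomogeneous hs hsm (hprime P hP) (hhom P hP) (hunm P hP) hQ hd
      (hQP P hP) hq hQQ₀ hQ₀ ⟨0, hs⟩
    rwa [blockDeg_uResultant hs hsm (hprime P hP) (hhom P hP) (hunm P hP) hQ hd (hQP P hP) hq hQQ₀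
      hQ₀] at h
  -- their product with exponents, in `\overline{J}(s)`
  set G : RU s m := ∏ P ∈ t, Gf P ^ primaryExponent P with hG
  have hG0 : G ≠ 0 := Finset.prod_ne_zero_iff.mpr fun P hP => pow_ne_zero _ (hGne P hP)
  have hGwh' : IsWeightedHomogeneous w G (∑ P ∈ t, primaryExponent P • (ideg P.radical (s + 1) * d)) :=
    IsWeightedHomogeneous.prod t (fun P => Gf P ^ primaryExponent P)
      (fun P => primaryExponent P • (ideg P.radical (s + 1) * d)) fun P hP => (hGwh P hP).pow _
  have hGJ : G ∈ elimIdeal J s := by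
    have h1 : G ∈ elimIdeal (∏ P ∈ t, (P.radical ⊔ Ideal.span {Q}) ^ primaryExponent P) s :=
      prod_pow_mem_elimIdeal t (fun P => P.radical ⊔ Ideal.span {Q}) primaryExponent Gf hGmem
    refine elimIdeal_mono ?_ s h1
    calc ∏ P ∈ t, (P.radical ⊔ Ideal.span {Q}) ^ primaryExponent P
        ≤ ∏ P ∈ t, (P.radical ^ primaryExponent P ⊔ Ideal.span {Q}) :=
          Finset.prod_le_prod' fun P _ => sup_pow_le _ _ _
      _ ≤ (∏ P ∈ t, P.radical ^ primaryExponent P) ⊔ Ideal.span {Q} := prod_sup_le t _ _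
      _ ≤ (∏ P ∈ t, P) ⊔ Ideal.span {Q} :=
          sup_le_sup_right (Finset.prod_le_prod' fun P _ => radical_pow_primaryExponent_le P) _
      _ ≤ I ⊔ Ideal.span {Q} := by
          refine sup_le_sup_right ?_ _
          rw [← ht.inf_eq]
          exact Ideal.prod_le_inf
      _ ≤ J := hle
  -- `F_J ∣ G`
  obtain ⟨tJ, htJ⟩ : ∃ t : Finset (Ideal (Rx m)), Submodule.IsMinimalPrimaryDecomposition J t :=
    Submodule.IsLasker.exists_isMinimalPrimaryDecomposition (Submodule.isLasker (Rx m) (Rx m)) J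
  have hprinc : (elimIdeal J s).IsPrincipal :=
    (NesterenkoPhilippon2001_ch3_prop_4_4_holds m s J hs (by omega) hJh hJ tJ htJ).1
  rw [← span_chowForm J s hprinc, Ideal.mem_span_singleton] at hGJ
  -- weights
  have hFwh : IsWeightedHomogeneous w (chowForm J s) (ideg J s) := chowForm_isWeightedHomogeneous J hs ⟨0, hs⟩
  have hle' := hFwh.weight_le_of_dvd hGwh' hG0 hGJ
  -- `∑ k_P deg √P · d = deg I · d`
  have hsum := sum_primaryExponent_mul_ideg_eq NesterenkoPhilippon2001_ch3_prop_4_4_holds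
    (r := s + 1) (Nat.succ_pos s) hsm hIh hI ht
  calc ideg J s ≤ ∑ P ∈ t, primaryExponent P • (ideg P.radical (s + 1) * d) := hle'
    _ = (∑ P ∈ t, primaryExponent P * ideg P.radical (s + 1)) * d := by
        rw [Finset.sum_mul]
        exact Finset.sum_congr rfl fun P _ => by rw [smul_eq_mul, mul_assoc]
    _ = ideg I (s + 1) * d := by rw [hsum]

end Nesterenko

end Literature.NumberTheory.Transcendental
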